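import Literature.Probability.RandomPlanarGeometry.HexSAWStripSurfaceGrowthSqrtScale
import Literature.Probability.RandomPlanarGeometry.HexSAWStripSurfaceGrowthBounds
import Literature.Probability.RandomPlanarGeometry.HexSAWStripWidthOne
import Literature.Probability.RandomPlanarGeometry.HexSAWStripSurfaceWidthOne
import HarnessLib

/-!
# The growth rate of the width-one strip is `ν_1(y) = √y` (the zigzag `S_1`), so `ν_1(y_1) = √(2+√2) = x_c⁻¹`

Topic `Literature/Probability/RandomPlanarGeometry` (rider on `HexSAWStripSurfaceGrowth.lean` — `HV.stripChains`, `HV.stripZL`,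
`HV.stripNu`, `HV.tendsto_stripZL_rpow` —, `HexSAWStripSurfaceGrowthSqrtScale.lean` — `HV.two_mul_topCnt_le`, `HV.sqrt_le_stripNu` —, and
`HexSAWStripWidthOne.lean` — the width-one strip is a path: `HV.pos1`, `HV.pos1_step`, `HV.eq_of_pos1_eq`, `HV.eq_mul_of_unit_steps`).
Source frame: N. R. Beaton, M. Bousquet-Mélou, J. de Gier, H. Duminil-Copin, A. J. Guttmann, *The critical fugacity for surface adsorption of
self-avoiding walks on the honeycomb lattice is `1 + √2`*, Comm. Math. Phys. 326 (2014), arXiv:1109.0358v5, proof of Corollary 8 (p. 12):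
"`ρ_T(y) ≤ 1/√y` as can be seen by counting zig-zag paths, as in the proof of Proposition 5" (`ρ_T(y) = 1/μ_T(1,y)`) — at `T = 1`
the strip IS the zig-zag path, so the bound is an equality.

## What is proved (namespace `Literature.Probability.RandomPlanarGeometry.SAW.HV`)

* `snd_eq_zero_of_mem_stripChains_one` — the vertices of a chain of `S_1` have `x₁ = 0` (levels `0, 1`);
* `le_two_mul_topCnt_of_mem_stripChains_one` — `n ≤ 2 · topCnt 1 ω` for `ω ∈ stripChains 1 n` (levels alternate `0, 1`);
* `card_stripChains_one_le` — `|stripChains 1 n| ≤ 4` (a chain of the path is fixed by its head and its direction);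
* `stripZL_one_le` — `Z_{1,n}(y) ≤ 4 · max(1, y) · (√y)ⁿ` (`y ≥ 0`);
* ★ **`stripNu_one_le_sqrt`**, **`stripNu_one_eq_sqrt`** — `ν_1(y) = √y` for every `y > 0`;
* `stripNu_one_stripYT_one` — `ν_1(y_1) = x_c⁻¹` directly (`y_1 = 2 + √2`, `x_c = 1/√(2+√2)`): the width-one instance of the tree's
  threshold identification `ν_T(y_T) = x_c⁻¹` (`HexSAWStripSurfaceThresholdRate`), by closed form.

Used by the lane to state the sharpness of the geometric tails of `HexSAWStripSurfaceClassTails` at `T = 1` (rate `(x_c ν_1(y))² = x_c² y`).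
Label: lane corollary XS.  Lane «pcv-sawmu», a-p2 g15.  EDITIONS: ed.2 = ed.1 (088bb5e7) code verbatim, the Corollary 8
quotation in printed form per ref g54 §92.4 (NU-1).
-/

noncomputable section

open Finset Filter Topology

namespace Literature.Probability.RandomPlanarGeometry.SAW.HV

/-! ### Chains of the width-one strip -/

/-- Vertices of levels `0, 1` have `x₁ = 0`. [cite: DuminilCopinSmirnov2012, §3 (the levels of S_T)] -/
theorem snd_eq_zero_of_lev {v : HV} (h0 : 0 ≤ lev v) (h1 : lev v ≤ 1) : v.2.1 = 0 := by
  obtain ⟨a, b, c⟩ := v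
  cases c <;> simp [lev, bit] at h0 h1 ⊢ <;> omega

/-- The vertices of a chain of `S_1` have `x₁ = 0`. [cite: DuminilCopinSmirnov2012, §3 (the strip S_1)] -/
theorem snd_eq_zero_of_mem_stripChains_one {n : ℕ} {l : List HV} (hl : l ∈ stripChains 1 n) : ∀ v ∈ l, v.2.1 = 0 := by
  intro v hv
  obtain ⟨-, -, -, -, hin⟩ := mem_stripChains_iff.1 hl
  have h := hin v hv
  exact snd_eq_zero_of_lev h.1 (by simpa using h.2)

/-- Counting lemma: along a chain of `ℍ` whose levels stay `≥ 0`, at most every other vertex is on the level `0`: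
`2 · #{level 0} ≤ length + 1`. [folklore] -/
private theorem two_mul_botCnt_le_aux :
    ∀ (l : List HV), l.IsChain hvGraph.Adj → (∀ v ∈ l, 0 ≤ lev v) →
      2 * (l.filter fun v => lev v = 0).length ≤ l.length + 1
  | [], _, _ => by simp
  | [a], _, _ => by
    simp only [List.filter_cons, List.filter_nil, List.length_singleton]
    split_ifs <;> simp
  | a :: b :: l, hc, hlev => by
    rw [List.isChain_cons_cons] at hc
    obtain ⟨hab, hbl⟩ := hc
    have hlevbl : ∀ v ∈ b :: l, 0 ≤ lev v := fun v hv => hlev v (List.mem_cons_of_mem a hv)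
    have hlevl : ∀ v ∈ l, 0 ≤ lev v := fun v hv => hlevbl v (List.mem_cons_of_mem b hv)
    have hcl : l.IsChain hvGraph.Adj := by
      cases l with
      | nil => exact List.IsChain.nil
      | cons c l' => exact (List.isChain_cons_cons.1 hbl).2
    have ih1 := two_mul_botCnt_le_aux (b :: l) hbl hlevbl
    have ih2 := two_mul_botCnt_le_aux l hcl hlevl
    have hla := hlev a (by simp)
    have hlb := hlev b (by simp)
    simp only [List.filter_cons, List.length_cons] at ih1 ih2 ⊢
    by_cases ha : lev a = 0
    · have hb : ¬ lev b = 0 := by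
        rcases lev_eq_of_adj hab with h | h <;> omega
      simp only [ha, decide_true, hb, decide_false, List.length_cons, Bool.false_eq_true, ↓reduceIte] at ih2 ⊢
      omega
    · simp only [ha, decide_false, Bool.false_eq_true, ↓reduceIte]
      omega

/-- **`n ≤ 2 · topCnt 1 ω`** for `ω ∈ stripChains 1 n`: in `S_1` the levels alternate `0, 1`, so at least every other vertex is on the top
level `1`. [cite: BeatonBousquetMelouDeGierDuminilCopinGuttmann2014, proof of Corollary 8 (arXiv v5 p. 12: zig-zag paths); DuminilCopinSmirnov2012, §3] -/
theorem le_two_mul_topCnt_of_mem_stripChains_one {n : ℕ} {l : List HV} (hl : l ∈ stripChains 1 n) : n ≤ 2 * topCnt 1 l := by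
  obtain ⟨hchain, -, hlen, -, hin⟩ := mem_stripChains_iff.1 hl
  have hbot := two_mul_botCnt_le_aux l hchain fun v hv => (hin v hv).1
  -- `#top + #bottom = n + 1`
  have e1 := List.length_eq_length_filter_add (l := l) (fun v => decide (lev v = 2 * ((1 : ℕ) : ℤ) - 1))
  have e2 : (l.filter fun v => !decide (lev v = 2 * ((1 : ℕ) : ℤ) - 1)) = l.filter fun v => decide (lev v = 0) := by
    refine List.filter_congr fun v hv => ?_
    have h := hin v hv
    have h1 : lev v ≤ 1 := by simpa using h.2
    have h0 := h.1
    by_cases hv1 : lev v = 1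
    · simp [hv1]
    · have hv0 : lev v = 0 := by omega
      simp [hv0]
  rw [e2] at e1
  unfold topCnt
  omega

/-! ### At most four chains of each length -/

/-- A chain of `S_1` is a monotone run of the path: `pos1 ω_i = pos1 ω_0 + s · i` with `s = pos1 ω_1 − pos1 ω_0 ∈ {±1}`.
[cite: DuminilCopinSmirnov2012, §3 (the strip S_1 is a zig-zag path)] -/
theorem pos1_getElem_of_mem_stripChains_one {n : ℕ} {l : List HV} (hl : l ∈ stripChains 1 n) :
    ∃ s : ℤ, (s = 1 ∨ s = -1 ∨ n = 0) ∧ ∀ (i : ℕ) (hi : i < l.length), pos1 l[i] = pos1 (l[0]'(by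
      have := (mem_stripChains_iff.1 hl).2.2.1; omega)) + s * i := by
  have hmem := hl
  obtain ⟨hchain, hnd, hlen, -, -⟩ := mem_stripChains_iff.1 hl
  have hx := snd_eq_zero_of_mem_stripChains_one hmem
  have h0 : 0 < l.length := by omega
  set f : ℕ → ℤ := fun i => if hi : i < l.length then pos1 l[i] - pos1 (l[0]'h0) else 0 with hf
  have hstep : ∀ i, i + 1 ≤ n → f (i + 1) = f i + 1 ∨ f (i + 1) = f i - 1 := by
    intro i hi
    have hi1 : i + 1 < l.length := by omega
    have hi0 : i < l.length := by omega
    have hadj : hvGraph.Adj l[i] l[i + 1] := hchain.getElem i hi1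
    have hp := pos1_step (hx _ (List.getElem_mem hi0)) (hx _ (List.getElem_mem hi1)) hadj
    simp only [hf, dif_pos hi1, dif_pos hi0]
    rcases hp with hp | hp <;> [left; right] <;> omega
  have hinj : ∀ i j, i ≤ n → j ≤ n → f i = f j → i = j := by
    intro i j hi hj hij
    have hi' : i < l.length := by omega
    have hj' : j < l.length := by omega
    simp only [hf, dif_pos hi', dif_pos hj'] at hij
    have hv : l[i] = l[j] := eq_of_pos1_eq (hx _ (List.getElem_mem hi')) (hx _ (List.getElem_mem hj')) (by omega)
    exact (hnd.getElem_inj_iff).1 hv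
  have hf0 : f 0 = 0 := by simp [hf, dif_pos h0]
  have key := eq_mul_of_unit_steps hf0 hstep hinj
  refine ⟨f 1, ?_, fun i hi => ?_⟩
  · rcases Nat.eq_zero_or_pos n with hn | hn
    · exact Or.inr (Or.inr hn)
    · have := hstep 0 (by omega)
      rw [zero_add, hf0] at this
      rcases this with h | h
      · exact Or.inl (by omega)
      · exact Or.inr (Or.inl (by omega))
  · have h := key i (by omega)
    simp only [hf, dif_pos hi] at h
    linarith

/-- **`|stripChains 1 n| ≤ 4`**: a chain of the path `S_1` is determined by its head (two standard heads) and its direction.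
[cite: DuminilCopinSmirnov2012, §3 (the strip S_1); MadrasSlade1993, §8.2 (walks of a tube up to translation)] -/
theorem card_stripChains_one_le (n : ℕ) : (stripChains 1 n).card ≤ 4 := by
  classical
  -- the signature map: (head, direction)
  let φ : List HV → HV × ℤ := fun l =>
    (l.headD hvOrigin, if h : 1 < l.length then pos1 (l[1]'h) - pos1 (l[0]'(by omega)) else 1)
  have himg : (stripChains 1 n).image φ ⊆ stdHeads 1 ×ˢ ({1, -1} : Finset ℤ) := by
    intro q hq
    rw [mem_image] at hq
    obtain ⟨l, hl, rfl⟩ := hq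
    obtain ⟨hchain, hnd, hlen, ⟨v, hv, hv0⟩, hin⟩ := mem_stripChains_iff.1 hl
    rw [mem_product]
    constructor
    · have hhead : l.headD hvOrigin = v := by
        rw [List.headD_eq_head?_getD, hv, Option.getD_some]
      have hvin := hin v (List.mem_of_mem_head? hv)
      show (φ l).1 ∈ stdHeads 1
      simp only [φ, hhead]
      exact mem_stdHeads_iff.2 ⟨hv0, hvin.1, hvin.2⟩
    · show (φ l).2 ∈ ({1, -1} : Finset ℤ)
      simp only [φ]
      split_ifs with h
      · obtain ⟨s, hs, hall⟩ := pos1_getElem_of_mem_stripChains_one hl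
        have h1 := hall 1 h
        simp only [Nat.cast_one, mul_one] at h1
        rcases hs with hs | hs | hs
        · simp [h1, hs]
        · simp [h1, hs]
        · omega
      · simp
  have hinj : Set.InjOn φ (stripChains 1 n : Set (List HV)) := by
    intro l hl l' hl' hφ
    rw [mem_coe] at hl hl'
    obtain ⟨hchain, hnd, hlen, ⟨v, hv, -⟩, -⟩ := mem_stripChains_iff.1 hl
    obtain ⟨hchain', hnd', hlen', ⟨v', hv', -⟩, -⟩ := mem_stripChains_iff.1 hl'
    have hx := snd_eq_zero_of_mem_stripChains_one hl
    have hx' := snd_eq_zero_of_mem_stripChains_one hl'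
    obtain ⟨s, hs, hall⟩ := pos1_getElem_of_mem_stripChains_one hl
    obtain ⟨s', hs', hall'⟩ := pos1_getElem_of_mem_stripChains_one hl'
    have hφ1 := congrArg Prod.fst hφ
    have hφ2 := congrArg Prod.snd hφ
    simp only [φ] at hφ1 hφ2
    have h0 : 0 < l.length := by omega
    have h0' : 0 < l'.length := by omega
    -- heads agree
    have hh : l[0]'h0 = l'[0]'h0' := by
      have e1 : l.headD hvOrigin = l[0]'h0 := by
        rw [List.headD_eq_head?_getD, List.head?_eq_getElem?, List.getElem?_eq_getElem h0, Option.getD_some]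
      have e2 : l'.headD hvOrigin = l'[0]'h0' := by
        rw [List.headD_eq_head?_getD, List.head?_eq_getElem?, List.getElem?_eq_getElem h0', Option.getD_some]
      rw [← e1, ← e2, hφ1]
    -- directions agree (when `n ≥ 1`)
    refine List.ext_getElem (by omega) fun i hi hi' => ?_
    apply eq_of_pos1_eq (hx _ (List.getElem_mem hi)) (hx' _ (List.getElem_mem hi'))
    rw [hall i hi, hall' i hi', hh]
    rcases Nat.eq_zero_or_pos n with hn | hn
    · have : i = 0 := by omega
      subst this; simp
    · have h1 : 1 < l.length := by omega
      have h1' : 1 < l'.length := by omega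
      rw [dif_pos h1, dif_pos h1'] at hφ2
      have e := hall 1 h1
      have e' := hall' 1 h1'
      simp only [Nat.cast_one, mul_one] at e e'
      have hh' : pos1 (l[0]'h0) = pos1 (l'[0]'h0') := by rw [hh]
      have hss : s = s' := by linarith
      rw [hss]
  calc (stripChains 1 n).card = ((stripChains 1 n).image φ).card := (card_image_of_injOn hinj).symm
    _ ≤ (stdHeads 1 ×ˢ ({1, -1} : Finset ℤ)).card := card_le_card himg
    _ ≤ 4 := by
        rw [card_product]
        have h1 := card_stdHeads_le 1
        have h2 : (({1, -1} : Finset ℤ)).card ≤ 2 := Finset.card_le_two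
        calc (stdHeads 1).card * ({1, -1} : Finset ℤ).card ≤ 2 * 2 := Nat.mul_le_mul (by omega) h2
          _ = 4 := by norm_num

/-! ### `Z_{1,n}(y) ≤ 4 max(1,y) (√y)ⁿ` and `ν_1(y) = √y` -/

/-- **`Z_{1,n}(y) ≤ 4 · max(1, y) · (√y)ⁿ`** (`y ≥ 0`): at most four chains, each with between `n/2` and `(n+2)/2` top vertices.
[cite: BeatonBousquetMelouDeGierDuminilCopinGuttmann2014, proof of Corollary 8 (arXiv v5 p. 12: counting zig-zag paths); lane: width one] -/
theorem stripZL_one_le (n : ℕ) {y : ℝ} (hy : 0 ≤ y) :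
    stripZL 1 n y ≤ 4 * max 1 y * Real.sqrt y ^ n := by
  have hs0 : 0 ≤ Real.sqrt y := Real.sqrt_nonneg y
  have hsq : Real.sqrt y ^ 2 = y := Real.sq_sqrt hy
  have hterm : ∀ l ∈ stripChains 1 n, y ^ topCnt 1 l ≤ max 1 y * Real.sqrt y ^ n := by
    intro l hl
    have hlo := le_two_mul_topCnt_of_mem_stripChains_one hl
    have hhi := two_mul_topCnt_le hl
    have hrew : y ^ topCnt 1 l = Real.sqrt y ^ (2 * topCnt 1 l) := by rw [pow_mul, hsq]
    rw [hrew]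
    rcases le_total y 1 with hy1 | hy1
    · -- `√y ≤ 1`: larger exponent is smaller
      have hs1 : Real.sqrt y ≤ 1 := by simpa using Real.sqrt_le_sqrt hy1
      calc Real.sqrt y ^ (2 * topCnt 1 l) ≤ Real.sqrt y ^ n := pow_le_pow_of_le_one hs0 hs1 hlo
        _ ≤ max 1 y * Real.sqrt y ^ n := le_mul_of_one_le_left (pow_nonneg hs0 n) (le_max_left _ _)
    · -- `√y ≥ 1`
      have hs1 : 1 ≤ Real.sqrt y := by simpa using Real.sqrt_le_sqrt hy1
      calc Real.sqrt y ^ (2 * topCnt 1 l) ≤ Real.sqrt y ^ (n + 2) := pow_le_pow_right₀ hs1 hhi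
        _ = y * Real.sqrt y ^ n := by rw [pow_add, hsq]; ring
        _ ≤ max 1 y * Real.sqrt y ^ n := mul_le_mul_of_nonneg_right (le_max_right _ _) (pow_nonneg hs0 n)
  calc stripZL 1 n y = ∑ l ∈ stripChains 1 n, y ^ topCnt 1 l := rfl
    _ ≤ ∑ _l ∈ stripChains 1 n, max 1 y * Real.sqrt y ^ n := sum_le_sum hterm
    _ = (stripChains 1 n).card * (max 1 y * Real.sqrt y ^ n) := by rw [sum_const, nsmul_eq_mul]
    _ ≤ 4 * (max 1 y * Real.sqrt y ^ n) := by
        refine mul_le_mul_of_nonneg_right ?_ (by positivity)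
        exact_mod_cast card_stripChains_one_le n
    _ = 4 * max 1 y * Real.sqrt y ^ n := by ring

/-- `C^{1/n} → 1` for `C > 0` (along `n → ∞`, with `1/0 = 0` harmless). [folklore] -/
private theorem tendsto_const_rpow_one_div {C : ℝ} (hC : 0 < C) :
    Tendsto (fun n : ℕ => C ^ (1 / (n : ℝ))) atTop (𝓝 1) := by
  have h := ((continuous_iff_continuousAt.mpr fun _ => Real.continuousAt_const_rpow hC.ne').tendsto' 0 1 (Real.rpow_zero C)).comp
    (tendsto_inv_atTop_zero.comp tendsto_natCast_atTop_atTop)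
  refine h.congr fun n => ?_
  simp [one_div]

/-- ★ **`ν_1(y) ≤ √y`** (`y > 0`). [cite: BeatonBousquetMelouDeGierDuminilCopinGuttmann2014, proof of Corollary 8 (arXiv v5 p. 12: "ρ_T(y) ≤ 1/√y as can be seen by counting zig-zag paths"); lane: equality at T = 1] -/
theorem stripNu_one_le_sqrt {y : ℝ} (hy : 0 < y) : stripNu 1 y ≤ Real.sqrt y := by
  have hs0 : 0 < Real.sqrt y := Real.sqrt_pos.2 hy
  set K : ℝ := 4 * max 1 y with hK
  have hK0 : 0 < K := by rw [hK]; positivity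
  have hZ := tendsto_stripZL_rpow (T := 1) le_rfl hy
  have hR : Tendsto (fun n : ℕ => K ^ (1 / (n : ℝ)) * Real.sqrt y) atTop (𝓝 (Real.sqrt y)) := by
    have := (tendsto_const_rpow_one_div hK0).mul_const (Real.sqrt y)
    rwa [one_mul] at this
  refine le_of_tendsto_of_tendsto hZ hR ?_
  filter_upwards [eventually_ge_atTop 1] with n hn
  have hZ0 : 0 ≤ stripZL 1 n y := stripZL_nonneg 1 n hy.le
  have hn0 : (0 : ℝ) ≤ 1 / (n : ℝ) := by positivity
  calc (stripZL 1 n y) ^ (1 / (n : ℝ)) ≤ (K * Real.sqrt y ^ n) ^ (1 / (n : ℝ)) :=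
        Real.rpow_le_rpow hZ0 (stripZL_one_le n hy.le) hn0
    _ = K ^ (1 / (n : ℝ)) * (Real.sqrt y ^ n) ^ (1 / (n : ℝ)) := Real.mul_rpow hK0.le (pow_nonneg hs0.le n)
    _ = K ^ (1 / (n : ℝ)) * Real.sqrt y := by
        rw [← Real.rpow_natCast (Real.sqrt y) n, ← Real.rpow_mul hs0.le, mul_one_div_cancel (by positivity), Real.rpow_one]

/-- ★ **`ν_1(y) = √y`** for every `y > 0`: on the zig-zag `S_1` the printed bound `ρ_T(y) ≤ 1/√y` (i.e. `μ_T(1,y) ≥ √y`) is attained.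
[cite: BeatonBousquetMelouDeGierDuminilCopinGuttmann2014, proof of Corollary 8 (arXiv v5 p. 12); lane: width one] -/
theorem stripNu_one_eq_sqrt {y : ℝ} (hy : 0 < y) : stripNu 1 y = Real.sqrt y :=
  le_antisymm (stripNu_one_le_sqrt hy) (sqrt_le_stripNu le_rfl hy)

/-- **`ν_1(y_1) = x_c⁻¹`** (`y_1 = 2 + √2`, `x_c = 1/√(2+√2)`): the width-one instance of the threshold identification
`ν_T(y_T) = x_c⁻¹`, by closed form. [cite: BeatonBousquetMelouDeGierDuminilCopinGuttmann2014, Corollary 8 (arXiv v5 p. 12: ρ_T(y_T) = x_c); lane: T = 1 check] -/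
theorem stripNu_one_stripYT_one : stripNu 1 (stripYT 1) = hexCriticalFugacity⁻¹ := by
  rw [stripYT_one, stripNu_one_eq_sqrt (by positivity), hexCriticalFugacity, inv_inv]

end Literature.Probability.RandomPlanarGeometry.SAW.HV
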